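import Mathlib
import Summits.NavierStokesRegularity.FluidComputer.LinearisedLowerTailForms
import Summits.NavierStokesRegularity.FluidComputer.SharpH2Fluxes
import Literature.Analysis.FunctionSpaces.TorusLinearisedNSEnergy
import Literature.Analysis.FunctionSpaces.TorusLinearisedFormTruncation
import HarnessLib

/-!
# The three tail forms of the linearised operator with an ABSTRACT Poincaré constant `Λ` (cap g5, cell `ns-blowup`, 2026-08-26)

HONEST FRAMING (human ruling D-0035): nothing here is a claim about Navier–Stokes blow-up.
WHAT THIS IS NOT: not NS evidence. `LinearisedLowerTailForms.l2_tail_form_le` / `h1_tail_form_le`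
(p417451) and `SharpH2TailDissipativity.sharp_tail_form_le` (p433072) take the tail hypothesis in the
BALL form `fourierTruncate N w = 0` and hard-wire `Λ = 4π²(N² + 1)`. The certificates of the cell cut
their tails on CUBE shells `|k|_∞ ≥ K + 1`, where the sharp constant is `Λ = 4π²(K+1)²` and
`(K+1)² − 1` is not a square (cap g5 ERRATUM, STATUS ≈ l.3220). This file re-proves the three forms
VERBATIM with the three Poincaré facts as HYPOTHESES on an arbitrary `Λ > 0`:
`Λ∫‖w‖² ≤ ‖∇w‖₂²`, `Λ‖∇w‖₂² ≤ ‖Δw‖₂²`, `Λ‖Δw‖₂² ≤ ‖∇Δw‖₂²` — supplied for the cube tail by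
`FrequencyCutoffPoincare` with `Λ = 4π²(K+1)²`, and for the ball by `HighModePoincare`:

* `l2_tail_form_le_of_poincare` — (T0) `ν∫⟪Δw,w⟫ − ∫⟪(v·∇)w + (w·∇)v, w⟫ − ω‖w‖₂² ≤ (−νΛ − ω + s)‖w‖₂²`;
* `h1_tail_form_le_of_poincare` — (T1) with `−νΛ − ω + √d·L + s + √d·L'/√Λ`;
* `sharp_tail_form_le_of_poincare` — (T2), Frobenius host constants, `−νΛ − ω + (2F+s) + (L₂+2P)/√Λ + Q/Λ`.

Proofs are those of the cited files with the two/three Poincaré invocations replaced by the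
hypotheses (one writer's copy; no mathematics added). Mathlib + the cited files; no new definitions.
-/

noncomputable section

namespace Summit.NavierStokesRegularity.FluidComputer.AbstractPoincareTailForms

open Literature.Analysis.FunctionSpaces Literature.Analysis.FunctionSpaces.Torus MeasureTheory
open Summit.NavierStokesRegularity.FluidComputer.LinearisedLowerTailForms
open Summit.NavierStokesRegularity.FluidComputer.LaplacianConvectCommutator
open Summit.NavierStokesRegularity.FluidComputer.SharpH2Fluxes
open scoped RealInnerProductSpace

variable {d : Type*} [Fintype d] [DecidableEq d]

/-- (abstract Poincaré constant `Λ`) **(T0) `L²` tail dissipativity of the linearised operator.** For smooth divergence-free `v`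
with strain bound `|⟪a, Dv(x)a⟫| ≤ s‖a‖²` and a smooth tail field `w` (`P_N w = 0`):
`ν∫⟪Δw, w⟫ − ∫⟪(v·∇)w + (w·∇)v, w⟫ − ω∫‖w‖² ≤ (−ν·4π²(N²+1) − ω + s)·∫‖w‖²`. -/
theorem l2_tail_form_le_of_poincare {v w : UnitAddTorus d → EuclideanSpace ℝ d}
    (hv : IsSmooth v) (hdiv : IsDivFree v) (hw : IsSmooth w) {Λ : ℝ}
    (hP0 : Λ * (∫ x, ‖w x‖ ^ 2) ≤ gradNormSq w) {ν ω s : ℝ} (hν : 0 ≤ ν)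
    (hS : ∀ (x : UnitAddTorus d) (a : EuclideanSpace ℝ d), |⟪a, Torus.fderiv v x a⟫| ≤ s * ‖a‖ ^ 2) :
    ν * (∫ x, ⟪laplacian w x, w x⟫)
      - (∫ x, ⟪convect v w x + convect w v x, w x⟫)
      - ω * (∫ x, ‖w x‖ ^ 2)
      ≤ (-(ν * Λ) - ω + s) * (∫ x, ‖w x‖ ^ 2) := by
  set Y : ℝ := ∫ x, ‖w x‖ ^ 2 with hY
  have hvisc : ∫ x, ⟪laplacian w x, w x⟫ = -gradNormSq w :=
    integral_inner_laplacian_self_eq_neg_gradNormSq_of_isSmooth hw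
  have hP : Λ * Y ≤ gradNormSq w := hP0
  have hsplit : ∫ x, ⟪convect v w x + convect w v x, w x⟫
      = (∫ x, ⟪convect v w x, w x⟫) + ∫ x, ⟪convect w v x, w x⟫ := by
    simp_rw [inner_add_left]
    exact integral_add ((hv.convect hw).inner hw).integrable ((hw.convect hv).inner hw).integrable
  have h1 : ∫ x, ⟪convect v w x, w x⟫ = 0 := integral_inner_convect_self_eq_zero' hv hdiv hw
  have h2 := (abs_le.1 (abs_integral_inner_convect_le_of_strain hw hS)).1
  have h3 : ν * (Λ * Y) ≤ ν * gradNormSq w := mul_le_mul_of_nonneg_left hP hν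
  rw [hvisc, hsplit, h1, zero_add]
  nlinarith [h2, h3]

/-- (abstract Poincaré constant `Λ`) **(T1) `H¹` tail dissipativity of the linearised operator.** For smooth divergence-free `v`
with strain bound `s`, gradient bound `‖∂ₖv(x)‖ ≤ L` and Hessian-row bound
`(∑ⱼ‖∂ⱼ∂ₖv(x)‖²)^{1/2} ≤ L'`, and a smooth tail field `w` (`P_N w = 0`, `Λ = 4π²(N²+1)`,
`G = ‖∇w‖₂² = Torus.gradNormSq w`):
`−ν‖Δw‖₂² + ∫⟪(v·∇)w + (w·∇)v, Δw⟫ − ω·G ≤ (−νΛ − ω + √d·L + s + √d·L'/√Λ)·G`. -/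
theorem h1_tail_form_le_of_poincare {v w : UnitAddTorus d → EuclideanSpace ℝ d}
    (hv : IsSmooth v) (hdiv : IsDivFree v) (hw : IsSmooth w) {Λ : ℝ} (hΛpos : 0 < Λ)
    (hP0 : Λ * (∫ x, ‖w x‖ ^ 2) ≤ gradNormSq w)
    (hP1 : Λ * gradNormSq w ≤ ∫ x, ‖laplacian w x‖ ^ 2) {ν ω s L L' : ℝ} (hν : 0 ≤ ν) (hL0 : 0 ≤ L)
    (hL'0 : 0 ≤ L')
    (hS : ∀ (x : UnitAddTorus d) (a : EuclideanSpace ℝ d), |⟪a, Torus.fderiv v x a⟫| ≤ s * ‖a‖ ^ 2)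
    (hL : ∀ (k : d) (x : UnitAddTorus d), ‖partialDeriv k v x‖ ≤ L)
    (hL' : ∀ (k : d) (x : UnitAddTorus d),
      Real.sqrt (∑ j, ‖partialDeriv j (partialDeriv k v) x‖ ^ 2) ≤ L') :
    -(ν * ∫ x, ‖laplacian w x‖ ^ 2)
      + (∫ x, ⟪convect v w x + convect w v x, laplacian w x⟫)
      - ω * gradNormSq w
      ≤ (-(ν * Λ) - ω
          + Real.sqrt (Fintype.card d) * L + s
          + Real.sqrt (Fintype.card d) * L' / Real.sqrt Λ)
        * gradNormSq w := by
  -- names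
  set D : ℝ := Real.sqrt (Fintype.card d) with hD
  set G : ℝ := gradNormSq w with hG
  set Y : ℝ := ∫ x, ‖w x‖ ^ 2 with hY
  obtain ⟨g, hg⟩ : ∃ g : UnitAddTorus d → ℝ,
      g = fun x => Real.sqrt (∑ j, ‖partialDeriv j w x‖ ^ 2) := ⟨_, rfl⟩
  have hgx : ∀ x, g x = Real.sqrt (∑ j, ‖partialDeriv j w x‖ ^ 2) := fun x => by rw [hg]
  have hsΛ : 0 < Real.sqrt Λ := Real.sqrt_pos.mpr hΛpos
  have hD0 : 0 ≤ D := Real.sqrt_nonneg _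
  have hY0 : 0 ≤ Y := integral_nonneg fun x => sq_nonneg _
  have hg0 : ∀ x, 0 ≤ g x := fun x => by rw [hgx x]; exact Real.sqrt_nonneg _
  have hia : ∀ j, Integrable (fun x => ‖partialDeriv j w x‖ ^ 2) volume := fun j =>
    ((hw.partialDeriv j).norm_sq).integrable
  have hGdef : G = ∫ x, ∑ j, ‖partialDeriv j w x‖ ^ 2 := rfl
  have hG0 : 0 ≤ G := gradNormSq_nonneg _
  have hg2 : ∀ x, g x ^ 2 = ∑ j, ‖partialDeriv j w x‖ ^ 2 := fun x => by
    rw [hgx x]; exact Real.sq_sqrt (Finset.sum_nonneg fun j _ => sq_nonneg _)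
  have hGg : ∫ x, g x ^ 2 = G := by
    rw [hGdef]; exact integral_congr_ae (ae_of_all _ fun x => hg2 x)
  -- (1) viscous term and Poincaré
  have hP1 : Λ * G ≤ ∫ x, ‖laplacian w x‖ ^ 2 := hP1
  have hP0 : Λ * Y ≤ G := hP0
  have hvisc : -(ν * ∫ x, ‖laplacian w x‖ ^ 2) ≤ -(ν * (Λ * G)) := by
    have := mul_le_mul_of_nonneg_left hP1 hν; linarith
  -- (2) the convective pairing, integrated by parts
  set F : UnitAddTorus d → EuclideanSpace ℝ d := fun x => convect v w x + convect w v x with hF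
  have hFs : IsSmooth F := (hv.convect hw).add (hw.convect hv)
  have hibp : ∫ x, ⟪F x, laplacian w x⟫ = -∑ m, ∫ x, ⟪partialDeriv m F x, partialDeriv m w x⟫ :=
    integral_inner_laplacian_eq_neg_sum hFs hw
  -- Leibniz: ∂ₘF = (v·∇)∂ₘw + (∂ₘv·∇)w + (w·∇)∂ₘv + (∂ₘw·∇)v
  have hLeib : ∀ m x, partialDeriv m F x
      = convect v (partialDeriv m w) x + convect (partialDeriv m v) w x
        + (convect w (partialDeriv m v) x + convect (partialDeriv m w) v x) := by
    intro m x
    have hF' : F = convect v w + convect w v := by funext y; rfl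
    rw [hF', partialDeriv_add ((hv.convect hw).isContDiff (by simp)) ((hw.convect hv).isContDiff (by simp)),
      Pi.add_apply, partialDeriv_convect_eq_add_convect hv hw m x,
      partialDeriv_convect_eq_add_convect hw hv m x]
  -- the three first-order pieces, pointwise, and the vanishing top-order piece
  set p : d → UnitAddTorus d → ℝ := fun m x =>
    ⟪convect (partialDeriv m v) w x + (convect w (partialDeriv m v) x
      + convect (partialDeriv m w) v x), partialDeriv m w x⟫ with hp
  have hps : ∀ m, IsSmooth (fun x => convect (partialDeriv m v) w x
      + (convect w (partialDeriv m v) x + convect (partialDeriv m w) v x)) := fun m =>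
    ((hv.partialDeriv m).convect hw).add
      ((hw.convect (hv.partialDeriv m)).add ((hw.partialDeriv m).convect hv))
  have hpI : ∀ m, Integrable (p m) volume := fun m =>
    ((hps m).inner (hw.partialDeriv m)).integrable
  have hskew : ∀ m, ∫ x, ⟪convect v (partialDeriv m w) x, partialDeriv m w x⟫ = 0 := fun m =>
    integral_inner_convect_self_eq_zero' hv hdiv (hw.partialDeriv m)
  have hterm : ∀ m, ∫ x, ⟪partialDeriv m F x, partialDeriv m w x⟫ = ∫ x, p m x := by
    intro m
    have e : ∀ x, ⟪partialDeriv m F x, partialDeriv m w x⟫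
        = ⟪convect v (partialDeriv m w) x, partialDeriv m w x⟫ + p m x := by
      intro x
      rw [hLeib m x]
      simp only [hp]
      rw [← inner_add_left]
      congr 1
      abel
    simp_rw [e]
    rw [integral_add (((hv.convect (hw.partialDeriv m)).inner (hw.partialDeriv m)).integrable) (hpI m),
      hskew m, zero_add]
  have hconv : ∫ x, ⟪F x, laplacian w x⟫ = -∫ x, ∑ m, p m x := by
    rw [hibp, integral_finsetSum _ fun m _ => hpI m]
    congr 1
    exact Finset.sum_congr rfl fun m _ => hterm m
  -- pointwise bound of each piece
  have hpt : ∀ m x, |p m x| ≤ ‖partialDeriv m w x‖ * (L * g x)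
      + ‖partialDeriv m w x‖ * (L' * ‖w x‖) + s * ‖partialDeriv m w x‖ ^ 2 := by
    intro m x
    have hw1 : IsContDiff 1 w := hw.isContDiff (by simp)
    have hv1m : IsContDiff 1 (partialDeriv m v) := (hv.partialDeriv m).isContDiff (by simp)
    -- piece (ii): (∂ₘv·∇)w
    have a1 : |⟪convect (partialDeriv m v) w x, partialDeriv m w x⟫|
        ≤ ‖partialDeriv m w x‖ * (L * g x) := by
      have hcv := norm_convect_le_norm_mul_sqrt hw1 (partialDeriv m v) x
      rw [← hgx x] at hcv
      calc |⟪convect (partialDeriv m v) w x, partialDeriv m w x⟫|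
          ≤ ‖convect (partialDeriv m v) w x‖ * ‖partialDeriv m w x‖ := abs_real_inner_le_norm _ _
        _ ≤ (‖partialDeriv m v x‖ * g x) * ‖partialDeriv m w x‖ := by gcongr
        _ ≤ (L * g x) * ‖partialDeriv m w x‖ :=
            mul_le_mul_of_nonneg_right (mul_le_mul_of_nonneg_right (hL m x) (hg0 x)) (norm_nonneg _)
        _ = ‖partialDeriv m w x‖ * (L * g x) := by ring
    -- piece (iii): (w·∇)∂ₘv
    have a2 : |⟪convect w (partialDeriv m v) x, partialDeriv m w x⟫|
        ≤ ‖partialDeriv m w x‖ * (L' * ‖w x‖) := by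
      have hcv := norm_convect_le_norm_mul_sqrt hv1m w x
      calc |⟪convect w (partialDeriv m v) x, partialDeriv m w x⟫|
          ≤ ‖convect w (partialDeriv m v) x‖ * ‖partialDeriv m w x‖ := abs_real_inner_le_norm _ _
        _ ≤ (‖w x‖ * Real.sqrt (∑ j, ‖partialDeriv j (partialDeriv m v) x‖ ^ 2))
              * ‖partialDeriv m w x‖ := by gcongr
        _ ≤ (‖w x‖ * L') * ‖partialDeriv m w x‖ :=
            mul_le_mul_of_nonneg_right (mul_le_mul_of_nonneg_left (hL' m x) (norm_nonneg _))
              (norm_nonneg _)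
        _ = ‖partialDeriv m w x‖ * (L' * ‖w x‖) := by ring
    -- piece (iv): (∂ₘw·∇)v = Dv[∂ₘw], the strain form
    have a3 : |⟪convect (partialDeriv m w) v x, partialDeriv m w x⟫|
        ≤ s * ‖partialDeriv m w x‖ ^ 2 := by
      rw [real_inner_comm]
      exact hS x (partialDeriv m w x)
    have hsum : p m x = ⟪convect (partialDeriv m v) w x, partialDeriv m w x⟫
        + ⟪convect w (partialDeriv m v) x, partialDeriv m w x⟫
        + ⟪convect (partialDeriv m w) v x, partialDeriv m w x⟫ := by
      simp only [hp, inner_add_left]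
      ring
    rw [hsum]
    have t := (abs_add_le _ _).trans (add_le_add ((abs_add_le _ _).trans (add_le_add a1 a2)) a3)
    linarith
  -- sum over m, pointwise: Σₘ |pₘ| ≤ (D L + s) g² + D L' ‖w‖ g
  have hsum_pt : ∀ x, -(∑ m, p m x) ≤ (D * L + s) * g x ^ 2 + D * L' * (‖w x‖ * g x) := by
    intro x
    have h1 : -(∑ m, p m x) ≤ ∑ m, |p m x| := by
      rw [← Finset.sum_neg_distrib]
      exact Finset.sum_le_sum fun m _ => neg_le_abs _
    have h2 : (∑ m, |p m x|) ≤ ∑ m, (‖partialDeriv m w x‖ * (L * g x)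
        + ‖partialDeriv m w x‖ * (L' * ‖w x‖) + s * ‖partialDeriv m w x‖ ^ 2) :=
      Finset.sum_le_sum fun m _ => hpt m x
    have h3 : (∑ m, (‖partialDeriv m w x‖ * (L * g x)
        + ‖partialDeriv m w x‖ * (L' * ‖w x‖) + s * ‖partialDeriv m w x‖ ^ 2))
        = (L * g x + L' * ‖w x‖) * (∑ m, ‖partialDeriv m w x‖) + s * g x ^ 2 := by
      rw [Finset.sum_add_distrib, Finset.sum_add_distrib, ← Finset.sum_mul, ← Finset.sum_mul,
        ← Finset.mul_sum, hg2 x]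
      ring
    have h4 : (∑ m, ‖partialDeriv m w x‖) ≤ D * g x := by
      rw [hgx x]; exact sum_norm_partialDeriv_le_sqrt_card_mul w x
    have h5 : 0 ≤ L * g x + L' * ‖w x‖ :=
      add_nonneg (mul_nonneg hL0 (hg0 x)) (mul_nonneg hL'0 (norm_nonneg _))
    have h6 : (L * g x + L' * ‖w x‖) * (∑ m, ‖partialDeriv m w x‖)
        ≤ (L * g x + L' * ‖w x‖) * (D * g x) := mul_le_mul_of_nonneg_left h4 h5
    have h7 : (L * g x + L' * ‖w x‖) * (D * g x) + s * g x ^ 2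
        = (D * L + s) * g x ^ 2 + D * L' * (‖w x‖ * g x) := by ring
    linarith
  -- integrate
  have hgc : Continuous g := by rw [hg]; exact continuous_sqrt_sum_norm_partialDeriv_sq hw
  have hg2I : Integrable (fun x => g x ^ 2) volume := (hgc.pow 2).integrable_unitAddTorus
  have hwgI : Integrable (fun x => ‖w x‖ * g x) volume :=
    (hw.continuous.norm.mul hgc).integrable_unitAddTorus
  have hint1 : -∫ x, ∑ m, p m x ≤ (D * L + s) * G + D * L' * ∫ x, ‖w x‖ * g x := by
    have hB : Integrable (fun x => (D * L + s) * g x ^ 2 + D * L' * (‖w x‖ * g x)) volume :=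
      (hg2I.const_mul _).add (hwgI.const_mul _)
    have hSI : Integrable (fun x => ∑ m, p m x) volume := integrable_finsetSum _ fun m _ => hpI m
    have h1 : -∫ x, ∑ m, p m x = ∫ x, -(∑ m, p m x) := (integral_neg _).symm
    have h2 : ∫ x, -(∑ m, p m x) ≤ ∫ x, ((D * L + s) * g x ^ 2 + D * L' * (‖w x‖ * g x)) :=
      integral_mono hSI.neg hB fun x => hsum_pt x
    have h3 : ∫ x, ((D * L + s) * g x ^ 2 + D * L' * (‖w x‖ * g x))
        = (D * L + s) * G + D * L' * ∫ x, ‖w x‖ * g x := by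
      rw [integral_add (hg2I.const_mul _) (hwgI.const_mul _), integral_const_mul, integral_const_mul,
        hGg]
    rw [h1]
    exact h2.trans (le_of_eq h3)
  -- Cauchy–Schwarz and Poincaré for ∫ ‖w‖ g ≤ G / √Λ
  have hCS : ∫ x, ‖w x‖ * g x ≤ Real.sqrt Y * Real.sqrt G := by
    have h := integral_norm_mul_norm_le_sqrt_sq_mul_sqrt_sq (f := w) (g := g) (hw.memLp 2)
      (hgc.memLp_of_hasCompactSupport (HasCompactSupport.of_compactSpace _))
    have e1 : (fun x => ‖w x‖ * ‖g x‖) = fun x => ‖w x‖ * g x := by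
      funext x; rw [Real.norm_of_nonneg (hg0 x)]
    have e2 : (∫ x, ‖g x‖ ^ 2) = G := by
      rw [← hGg]
      exact integral_congr_ae (ae_of_all _ fun x => by
        show ‖g x‖ ^ 2 = g x ^ 2
        rw [Real.norm_of_nonneg (hg0 x)])
    rw [e1, e2] at h
    exact h
  have hsY : Real.sqrt Y ≤ Real.sqrt G / Real.sqrt Λ := by
    rw [le_div_iff₀ hsΛ, ← Real.sqrt_mul hY0]
    refine Real.sqrt_le_sqrt ?_
    rw [mul_comm]; exact hP0
  have hwg : ∫ x, ‖w x‖ * g x ≤ G / Real.sqrt Λ := by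
    have hsG : 0 ≤ Real.sqrt G := Real.sqrt_nonneg _
    calc ∫ x, ‖w x‖ * g x ≤ Real.sqrt Y * Real.sqrt G := hCS
      _ ≤ (Real.sqrt G / Real.sqrt Λ) * Real.sqrt G := mul_le_mul_of_nonneg_right hsY hsG
      _ = G / Real.sqrt Λ := by
          rw [div_mul_eq_mul_div, ← sq, Real.sq_sqrt hG0]
  -- assemble
  have hDL' : 0 ≤ D * L' := mul_nonneg hD0 hL'0
  have hconv' : ∫ x, ⟪convect v w x + convect w v x, laplacian w x⟫
      ≤ (D * L + s) * G + D * L' * (G / Real.sqrt Λ) := by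
    have e : (∫ x, ⟪convect v w x + convect w v x, laplacian w x⟫) = ∫ x, ⟪F x, laplacian w x⟫ :=
      rfl
    rw [e, hconv]
    exact hint1.trans (by nlinarith [mul_le_mul_of_nonneg_left hwg hDL'])
  have key : -(ν * ∫ x, ‖laplacian w x‖ ^ 2)
      + (∫ x, ⟪convect v w x + convect w v x, laplacian w x⟫) - ω * G
      ≤ -(ν * (Λ * G)) + ((D * L + s) * G + D * L' * (G / Real.sqrt Λ)) - ω * G := by
    linarith
  have e : -(ν * (Λ * G)) + ((D * L + s) * G + D * L' * (G / Real.sqrt Λ)) - ω * G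
      = (-(ν * Λ) - ω + D * L + s + D * L' / Real.sqrt Λ) * G := by
    simp only [div_eq_mul_inv]
    ring
  rw [e] at key
  exact key

/-- (abstract Poincaré constant `Λ`) **THEOREM 3-L, tail inequality, with Frobenius-structured host constants (the form that
certifies).** For a smooth divergence-free host `v` with strain `s`, gradient `F`, Laplacian `L₂`,
Hessian `P` and `∇Δ` bound `Q` (module docstring), and a smooth TAIL field `w` (no Fourier modes in
the ball `|k|² ≤ N²`), with `Λ = 4π²(N² + 1)`:
`ν∫⟪ΔΔw, Δw⟫ − ∫⟪(v·∇)w + (w·∇)v, ΔΔw⟫ − ω‖Δw‖₂² ≤ (−νΛ − ω + (2F + s) + (L₂ + 2P)Λ^{-1/2} + QΛ^{-1})·‖Δw‖₂²`.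
For `U = abc(1,1,1)`: `2F + s = 2√3 + √2`, `L₂ + 2P = √6 + 2√3`, `Q = √3` — the paper's
`c₀, c₁, c₂` of INSTAB-BRIDGE §11 l.109 (vs `(2d² + d)L = 21` in the entrywise form). -/
theorem sharp_tail_form_le_of_poincare {v w : UnitAddTorus d → EuclideanSpace ℝ d}
    (hv : IsSmooth v) (hdiv : IsDivFree v) (hw : IsSmooth w) {Λ : ℝ} (hΛpos : 0 < Λ)
    (hPoin0 : Λ * (∫ x, ‖w x‖ ^ 2) ≤ gradNormSq w)
    (hPoin1 : Λ * gradNormSq w ≤ ∫ x, ‖laplacian w x‖ ^ 2)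
    (hPoin2 : Λ * (∫ x, ‖laplacian w x‖ ^ 2) ≤ gradNormSq (laplacian w)) {ν ω s F L₂ P Q : ℝ} (hν : 0 ≤ ν)
    (hF0 : 0 ≤ F) (hP0 : 0 ≤ P) (hQ0 : 0 ≤ Q)
    (hS : ∀ (x : UnitAddTorus d) (a : EuclideanSpace ℝ d),
      |⟪∑ j, a j • partialDeriv j v x, a⟫| ≤ s * ‖a‖ ^ 2)
    (hF : ∀ x : UnitAddTorus d, ∑ j, ‖partialDeriv j v x‖ ^ 2 ≤ F ^ 2)
    (hL₂ : ∀ x : UnitAddTorus d, ‖laplacian v x‖ ≤ L₂)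
    (hP : ∀ x : UnitAddTorus d, ∑ m, ∑ j, ‖partialDeriv j (partialDeriv m v) x‖ ^ 2 ≤ P ^ 2)
    (hQ : ∀ x : UnitAddTorus d, ∑ j, ‖partialDeriv j (laplacian v) x‖ ^ 2 ≤ Q ^ 2) :
    ν * (∫ x, ⟪laplacian (laplacian w) x, laplacian w x⟫)
      - (∫ x, ⟪convect v w x + convect w v x, laplacian (laplacian w) x⟫)
      - ω * (∫ x, ‖laplacian w x‖ ^ 2)
      ≤ (-(ν * Λ) - ω
          + (2 * F + s)
          + (L₂ + 2 * P) / Real.sqrt Λ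
          + Q / Λ)
        * (∫ x, ‖laplacian w x‖ ^ 2) := by
  set Y : ℝ := ∫ x, ‖laplacian w x‖ ^ 2 with hY
  have hY0 : 0 ≤ Y := integral_nonneg fun x => sq_nonneg _
  have hsΛ : 0 < Real.sqrt Λ := Real.sqrt_pos.mpr hΛpos
  have hL20 : 0 ≤ L₂ := (norm_nonneg _).trans (hL₂ (0 : UnitAddTorus d))
  have hΔw : IsSmooth (laplacian w) := hw.laplacian
  -- (1) viscous term
  have hvisc : ∫ x, ⟪laplacian (laplacian w) x, laplacian w x⟫ ≤ -(Λ * Y) := by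
    rw [integral_inner_laplacian_self_eq_neg_gradNormSq_of_isSmooth hΔw]
    have h := hPoin2
    linarith
  -- (2) Poincaré for the tail
  have hG : gradNormSq w ≤ Y / Λ := by
    rw [le_div_iff₀ hΛpos, mul_comm]
    exact hPoin1
  have hwL2 : ∫ x, ‖w x‖ ^ 2 ≤ Y / Λ ^ 2 := by
    have h1 := hPoin0
    have h2 : Λ * ∫ x, ‖w x‖ ^ 2 ≤ Y / Λ := h1.trans hG
    rw [le_div_iff₀ hΛpos] at h2
    rw [le_div_iff₀ (by positivity)]
    nlinarith
  have hsqY : Real.sqrt Y ^ 2 = Y := Real.sq_sqrt hY0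
  have hs_g : Real.sqrt (gradNormSq w) ≤ Real.sqrt Y / Real.sqrt Λ := by
    rw [← Real.sqrt_div hY0]; exact Real.sqrt_le_sqrt hG
  have hs_w : Real.sqrt (∫ x, ‖w x‖ ^ 2) ≤ Real.sqrt Y / Λ := by
    have h := Real.sqrt_le_sqrt hwL2
    rwa [Real.sqrt_div hY0, Real.sqrt_sq hΛpos.le] at h
  -- (3) the two flux halves
  have h1 := abs_integral_inner_convect_bilaplacian_le_frob hv hdiv hw hF0 hF hL₂
  have h2 := abs_integral_inner_stretch_bilaplacian_le_frob hv hw hP0 hQ0 hS hP hQ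
  have hΔΔ : IsSmooth (laplacian (laplacian w)) := hw.laplacian.laplacian
  have hi1 : Integrable (fun x => ⟪convect v w x, laplacian (laplacian w) x⟫) volume :=
    (((hv.convect hw).continuous).inner hΔΔ.continuous).integrable_of_hasCompactSupport
      (HasCompactSupport.of_compactSpace _)
  have hi2 : Integrable (fun x => ⟪convect w v x, laplacian (laplacian w) x⟫) volume :=
    (((hw.convect hv).continuous).inner hΔΔ.continuous).integrable_of_hasCompactSupport
      (HasCompactSupport.of_compactSpace _)
  have e : ∫ x, ⟪convect v w x + convect w v x, laplacian (laplacian w) x⟫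
      = (∫ x, ⟪convect v w x, laplacian (laplacian w) x⟫)
        + ∫ x, ⟪convect w v x, laplacian (laplacian w) x⟫ := by
    simp_rw [inner_add_left]
    exact integral_add hi1 hi2
  have hsY0 : 0 ≤ Real.sqrt Y := Real.sqrt_nonneg _
  set B : ℝ := (2 * F + s) + (L₂ + 2 * P) / Real.sqrt Λ + Q / Λ with hB
  have hbr : (2 * F * Real.sqrt Y + L₂ * Real.sqrt (gradNormSq w))
        + (Q * Real.sqrt (∫ x, ‖w x‖ ^ 2) + 2 * P * Real.sqrt (gradNormSq w) + s * Real.sqrt Y)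
        ≤ B * Real.sqrt Y := by
    have e2 : L₂ * Real.sqrt (gradNormSq w) ≤ L₂ * (Real.sqrt Y / Real.sqrt Λ) :=
      mul_le_mul_of_nonneg_left hs_g hL20
    have e3 : Q * Real.sqrt (∫ x, ‖w x‖ ^ 2) ≤ Q * (Real.sqrt Y / Λ) := mul_le_mul_of_nonneg_left hs_w hQ0
    have e4 : 2 * P * Real.sqrt (gradNormSq w) ≤ 2 * P * (Real.sqrt Y / Real.sqrt Λ) :=
      mul_le_mul_of_nonneg_left hs_g (by linarith)
    have hsum := add_le_add (add_le_add (le_refl (2 * F * Real.sqrt Y)) e2)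
      (add_le_add (add_le_add e3 e4) (le_refl (s * Real.sqrt Y)))
    refine hsum.trans (le_of_eq ?_)
    simp only [hB]
    field_simp
    ring
  have hflux : |∫ x, ⟪convect v w x + convect w v x, laplacian (laplacian w) x⟫| ≤ B * Y := by
    rw [e]
    have h12 := (abs_add_le _ _).trans (add_le_add h1 h2)
    have h3 : (2 * F * Real.sqrt Y + L₂ * Real.sqrt (gradNormSq w)) * Real.sqrt Y
        + (Q * Real.sqrt (∫ x, ‖w x‖ ^ 2) + 2 * P * Real.sqrt (gradNormSq w) + s * Real.sqrt Y)
          * Real.sqrt Y ≤ B * Real.sqrt Y * Real.sqrt Y := by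
      rw [← add_mul]; exact mul_le_mul_of_nonneg_right hbr hsY0
    have e' : B * Real.sqrt Y * Real.sqrt Y = B * Y := by rw [mul_assoc, ← sq, hsqY]
    rw [e'] at h3
    exact h12.trans h3
  -- (4) assemble
  have hT : -(∫ x, ⟪convect v w x + convect w v x, laplacian (laplacian w) x⟫) ≤ B * Y :=
    (neg_le_abs _).trans hflux
  have hv' : ν * (∫ x, ⟪laplacian (laplacian w) x, laplacian w x⟫) ≤ -(ν * (Λ * Y)) := by
    have := mul_le_mul_of_nonneg_left hvisc hν; linarith
  have key : ν * (∫ x, ⟪laplacian (laplacian w) x, laplacian w x⟫)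
      - (∫ x, ⟪convect v w x + convect w v x, laplacian (laplacian w) x⟫)
      - ω * Y ≤ (-(ν * Λ) - ω + B) * Y := by nlinarith
  have eB : (-(ν * Λ) - ω + B) * Y
      = (-(ν * Λ) - ω + (2 * F + s) + (L₂ + 2 * P) / Real.sqrt Λ + Q / Λ) * Y := by
    simp only [hB]; ring
  rw [eB] at key
  exact key

end Summit.NavierStokesRegularity.FluidComputer.AbstractPoincareTailForms
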